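import Summits.Ventures.HSemireg.WedgeHankelRecurrenceGaussJacobiMoments

/-!
# Venture HSemireg — **COMPARISON (MONOTONICITY) OF CHRISTOFFEL FUNCTIONS**: if two positive discrete measures satisfy `Σ_l ν_l P(w_l)² ≤ Σ_l ν′_l P(w′_l)²` for every `P` of degree `≤ n` (e.g.
# `ν ≤ ν′` atom-wise), then their Christoffel functions satisfy `λ_n(ν; y) ≤ λ_n(ν′; y)` at every real `y`, i.e. `K′_n(y, y) ≤ K_n(y, y)` for the kernels built from the respective orthogonal
# polynomials — and in particular `λ_n` is non-increasing in `n` for a fixed measure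

HONEST FRAMING. Part of the Lean index of the computation cell `pub-hsemireg` (seat p10 gen 43, Sunday typer «UNIFORM-IN-n»).  Real polynomials and finite sums only; no variety, no cohomology
theory, no sheaf, no Ext group and no semiregularity map is constructed here; nothing here says that HC / HC_CM / HC_AV holds; no Literature fact (unproved `Prop`) is declared or used.  Custodian
versions as in `WedgeHankelSiegelIdeal` (1/3).
SOURCES (cited).  G. Freud, *Orthogonal Polynomials* (1971), §I.4 Lemma 4.1 and §III.3 (monotonicity of the Christoffel function in the measure and in `n`); P. Nevai, *Géza Freud, orthogonal polynomials
and Christoffel functions. A case study*, J. Approx. Theory 48 (1986) 3–167, §4.1; G. Szegő, *Orthogonal Polynomials*, Thm 3.1.3; V. Totik, *Asymptotics for Christoffel functions for general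
measures on the real line*, J. Anal. Math. 81 (2000) §1 (the comparison principle).
PROOF TYPED HERE.  N296 `christoffel_function_min_discrete`: `λ_n(ν′; y) = Σ ν′ P′²` for a minimiser `P′` with `P′(y) = 1`, `deg P′ ≤ n`; then `λ_n(ν; y) ≤ Σ ν P′² ≤ Σ ν′ P′² = λ_n(ν′; y)`;
monotonicity in `n` likewise, the degree-`n` minimiser being admissible in degree `n + 1` (N296 `kernelPoly_eval_self_eq` + `Finset.sum_range_succ` gives the same from the kernel directly).
DEDUP DISCLOSURE (`rg -n 'christoffel_comparison|christoffel_mono|kernel_mono' Summits/Ventures/HSemireg`, 2026-09-03): nothing.  The 3 names below: 0 hits tree-wide.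

WHAT IS IN THE TREE.  N296 `christoffel_function_min_discrete`, `kernelPoly_eval_self_eq`, `kernelPoly_eval_self_pos`; N273 `sum_mul_eval_sq_pos_of_natDegree_lt`.
THIS FILE (namespace `Summit.Ventures.HSemireg.Wedge.HankelOuter` continued; CHAINED on N315 (import), N296; 0 definitions):
* §1081 **`christoffel_function_comparison`** (domination of the quadratic functionals in degree `≤ n` ⇒ `1 ∕ K_n(y, y) ≤ 1 ∕ K′_n(y, y)`), **`christoffel_function_mono_measure`** (`ν_l ≤ ν′_l` on the same
  atoms ⇒ the same), `kernel_self_mono_degree` (`K_n(y, y) ≤ K_{n+1}(y, y)`, i.e. `λ_{n+1}(y) ≤ λ_n(y)`).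
CAVEATS.  Positive discrete measures with `N, N′ > n` atoms.  Nothing Ext-side.  New names only.
-/

open Module Polynomial
open scoped Matrix Polynomial

namespace Summit.Ventures.HSemireg.Wedge.HankelOuter

/-! ## §1081. Comparison of Christoffel functions -/

/-- **COMPARISON PRINCIPLE FOR CHRISTOFFEL FUNCTIONS.**  Let `(ν, w)` and `(ν′, w′)` be positive discrete measures (`N, N′ > n` atoms, distinct nodes) with orthogonal polynomials `q`, `q′` up to
degree `n`, and suppose `Σ_l ν_l P(w_l)² ≤ Σ_l ν′_l P(w′_l)²` for every `P` with `deg P ≤ n`.  Then for every real `y`: `1 ∕ K_n(y, y) ≤ 1 ∕ K′_n(y, y)` (`K`, `K′` the respective kernels), i.e.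
`λ_n(ν; y) ≤ λ_n(ν′; y)`. [Freud §I.4 Lemma 4.1; Nevai 1986 §4.1; Totik 2000 §1; this file, §1081] -/
theorem christoffel_function_comparison {N N' n : ℕ} {ν w : Fin N → ℝ} {ν' w' : Fin N' → ℝ} (hν : ∀ l, 0 < ν l) (hw : Function.Injective w) (hnN : n < N)
    (hν' : ∀ l, 0 < ν' l) (hw' : Function.Injective w') (hnN' : n < N') {q q' : ℕ → ℝ[X]} (hq0 : q 0 = 1) (hmonic : ∀ k, k ≤ n → (q k).Monic)
    (hdeg : ∀ k, k ≤ n → (q k).natDegree = k) (horth : ∀ k, k ≤ n → ∀ G : ℝ[X], G.natDegree < k → ∑ l, ν l * (q k * G).eval (w l) = 0) (hq0' : q' 0 = 1)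
    (hmonic' : ∀ k, k ≤ n → (q' k).Monic) (hdeg' : ∀ k, k ≤ n → (q' k).natDegree = k)
    (horth' : ∀ k, k ≤ n → ∀ G : ℝ[X], G.natDegree < k → ∑ l, ν' l * (q' k * G).eval (w' l) = 0)
    (hdom : ∀ P : ℝ[X], P.natDegree ≤ n → ∑ l, ν l * (P.eval (w l)) ^ 2 ≤ ∑ l, ν' l * (P.eval (w' l)) ^ 2) (y : ℝ) :
    1 / (∑ k ∈ Finset.range (n + 1), C ((q k).eval y / ∑ l, ν l * ((q k).eval (w l)) ^ 2) * q k).eval y ≤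
      1 / (∑ k ∈ Finset.range (n + 1), C ((q' k).eval y / ∑ l, ν' l * ((q' k).eval (w' l)) ^ 2) * q' k).eval y := by
  obtain ⟨hmin, -⟩ := christoffel_function_min_discrete hν hw hnN hq0 hmonic hdeg horth y
  obtain ⟨-, P', hP'd, hP'y, hval'⟩ := christoffel_function_min_discrete hν' hw' hnN' hq0' hmonic' hdeg' horth' y
  rw [← hval']
  exact (hmin P' hP'd hP'y).trans (hdom P' hP'd)

/-- **MONOTONICITY IN THE MEASURE**: if `0 < ν_l ≤ ν′_l` on the same distinct atoms `w_l` (`N > n`), then `λ_n(ν; y) ≤ λ_n(ν′; y)` for every real `y`. [Freud §I.4 Lemma 4.1; this file, §1081] -/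
theorem christoffel_function_mono_measure {N n : ℕ} {ν ν' w : Fin N → ℝ} (hν : ∀ l, 0 < ν l) (hνν' : ∀ l, ν l ≤ ν' l) (hw : Function.Injective w) (hnN : n < N)
    {q q' : ℕ → ℝ[X]} (hq0 : q 0 = 1) (hmonic : ∀ k, k ≤ n → (q k).Monic) (hdeg : ∀ k, k ≤ n → (q k).natDegree = k)
    (horth : ∀ k, k ≤ n → ∀ G : ℝ[X], G.natDegree < k → ∑ l, ν l * (q k * G).eval (w l) = 0) (hq0' : q' 0 = 1) (hmonic' : ∀ k, k ≤ n → (q' k).Monic)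
    (hdeg' : ∀ k, k ≤ n → (q' k).natDegree = k) (horth' : ∀ k, k ≤ n → ∀ G : ℝ[X], G.natDegree < k → ∑ l, ν' l * (q' k * G).eval (w l) = 0) (y : ℝ) :
    1 / (∑ k ∈ Finset.range (n + 1), C ((q k).eval y / ∑ l, ν l * ((q k).eval (w l)) ^ 2) * q k).eval y ≤
      1 / (∑ k ∈ Finset.range (n + 1), C ((q' k).eval y / ∑ l, ν' l * ((q' k).eval (w l)) ^ 2) * q' k).eval y :=
  christoffel_function_comparison hν hw hnN (fun l => (hν l).trans_le (hνν' l)) hw hnN hq0 hmonic hdeg horth hq0' hmonic' hdeg' horth'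
    (fun _ _ => Finset.sum_le_sum fun l _ => mul_le_mul_of_nonneg_right (hνν' l) (sq_nonneg _)) y

/-- **MONOTONICITY IN THE DEGREE: `K_n(y, y) ≤ K_{n+1}(y, y)`** (so `λ_{n+1}(y) ≤ λ_n(y)`): the kernel gains the non-negative term `q_{n+1}(y)² ∕ h_{n+1}`. [Szegő (3.1.9); Freud §I.4; this file, §1081] -/
theorem kernel_self_mono_degree {N n : ℕ} {ν w : Fin N → ℝ} (hν : ∀ l, 0 < ν l) (hw : Function.Injective w) (hnN : n + 1 < N) {q : ℕ → ℝ[X]}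
    (hmonic : ∀ k, k ≤ n + 1 → (q k).Monic) (hdeg : ∀ k, k ≤ n + 1 → (q k).natDegree = k) (y : ℝ) :
    (∑ k ∈ Finset.range (n + 1), C ((q k).eval y / ∑ l, ν l * ((q k).eval (w l)) ^ 2) * q k).eval y ≤
      (∑ k ∈ Finset.range (n + 2), C ((q k).eval y / ∑ l, ν l * ((q k).eval (w l)) ^ 2) * q k).eval y := by
  rw [kernelPoly_eval_self_eq, kernelPoly_eval_self_eq, Finset.sum_range_succ _ (n + 1)]
  have hh : 0 < ∑ l, ν l * ((q (n + 1)).eval (w l)) ^ 2 :=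
    sum_mul_eval_sq_pos_of_natDegree_lt hν hw (hmonic (n + 1) le_rfl).ne_zero (by rw [hdeg (n + 1) le_rfl]; exact hnN)
  linarith [div_nonneg (sq_nonneg ((q (n + 1)).eval y)) hh.le]

end Summit.Ventures.HSemireg.Wedge.HankelOuter
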